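import Mathlib.Geometry.Manifold.Riemannian.Basic
import Mathlib.Analysis.InnerProductSpace.PiL2
import Mathlib.Analysis.Calculus.Deriv.AffineMap
import Mathlib.Geometry.Euclidean.Volume.Measure
import Mathlib.MeasureTheory.Measure.Lebesgue.EqHaar
import Mathlib.MeasureTheory.Measure.Haar.InnerProductSpace
import Literature.Geometry.Lorentzian.Volume
import HarnessLib

/-!
# The Riemannian measure in charts: `dvol_h = √(det h_{ij}) dy`

Companion of `Volume.lean`. There the **Riemannian measure** of a manifold `N` with a `C^n`
Riemannian metric `h` is defined intrinsically as `μHE[dim]`, the Euclidean-normalised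
top-dimensional Hausdorff measure of the length (path) metric `riemannianEDist` of `h`, and the
classical chart formula is vendored as the named fact `riemannianMeasure_eq_integral_sqrt_det`.
This file proves that fact (`riemannianMeasure_eq_integral_sqrt_det_holds`): for a measurable
subset `S` of the domain of the extended chart `φ = extChartAt I x`,

  `riemannianMeasure h S = ∫_{φ S} √(det h_{ij}(y)) dy`,

where `h_{ij}(y) = h(∂ᵢ, ∂ⱼ)` is the Gram matrix `chartGramMatrix h x y` of the coordinate vector
fields `∂ᵢ = D(φ⁻¹)(y) eᵢ`. This is Federer's identification of the Hausdorff measure of a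
Riemannian manifold with its Riemannian volume (Federer 1969, §3.2.46, via the area formula
§3.2.3; Chavel 2006, §III.3 and (III.5.1)). The proof is self-contained on top of Mathlib and works
for merely *continuous* metrics on `C¹` manifolds, possibly with boundary or corners, and without
second countability.

## Proof

Everything is first developed for a manifold `M` with `[EMetricSpace M] [IsRiemannianManifold I M]`
(the distance *is* the length distance) whose tangent spaces carry a continuously varying inner
product (`[IsContinuousRiemannianBundle F (TangentSpace I)]`), modelled on a finite-dimensional real
inner product space `F` (`μHE[dim F] = volume` on `F`), and specialised at the end to the `letI`
structures of `riemannianVolume`.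

1. *The metric in a chart is continuous* (`continuousOn_inner_symmL_symmL`,
   `continuousOn_bilinearComp_symmL`): with `e = trivializationAt F (TangentSpace I) x` (whose
   inverse `e.symmL ℝ p = D(φ⁻¹)(φ p)`, Mathlib's `TangentBundle.symmL_trivializationAt`), the
   bilinear form `p ↦ ((v, w) ↦ ⟪e.symmL p v, e.symmL p w⟫_p)` is continuous in operator norm on the
   chart domain (continuity of the inner product of continuous sections,
   `ContinuousOn.inner_bundle`, plus finite dimension).
2. *Sharp norm comparison* (`eventually_norm_symmL_le_and_norm_comp_le`): if `A` is a linear map of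
   `F` with `‖A w‖ = ‖e.symmL p₀ w‖_{p₀}` (a "square root" of the metric at `p₀`; one exists,
   `exists_norm_eq_norm_symmL`), then for every `C > 1` and all `p` near `p₀`:
   `‖e.symmL p w‖_p ≤ C ‖A w‖` and `‖A (Dφ_p v)‖ ≤ C ‖v‖_p`.
3. *Sharp two-sided distance comparison* (`riemannianEDist_symm_le_of_forall_norm_mfderivWithin_le`,
   `exists_enorm_sub_le_mul_riemannianEDist_of_forall_norm_le`,
   `exists_nhds_riemannianEDist_le_and_edist_le`): on a neighbourhood `U` of `p₀` the map
   `A ∘ φ` is `C`-bi-Lipschitz for the length distance. The upper bound pulls the segment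
   `[φ q, φ q']` back to a `C¹` path (as in Mathlib's `eventually_riemannianEDist_le_edist_extChartAt`);
   the lower bound follows short paths, which stay in `U` (as in Mathlib's
   `setOf_riemannianEDist_lt_subset_nhds`), and integrates `‖A Dφ γ'‖ ≤ C ‖γ'‖`.
4. *Hausdorff measures* (`exists_nhds_hausdorffMeasure_le_and_le`): Lipschitz maps expand `μH[d]`
   by at most `Lip^d` (Federer 1969, §2.10.11; Mathlib's `LipschitzOnWith.hausdorffMeasure_image_le`),
   so `C^{-d} μH[d](A φ s) ≤ μH[d] s ≤ C^d μH[d](A φ s)` for `s ⊆ U`; and in `F`,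
   `μHE[dim](A B) = |det A| · vol B` with `|det A| = √(det h_{ij}(φ p₀))`
   (`sqrt_det_gram_eq_abs_det`, the Gram identity `det(⟪A eᵢ, A eⱼ⟫) = (det A)²`).
5. *Assembly* (`exists_isOpen_euclideanHausdorffMeasure_le_and_lintegral_le`,
   `euclideanHausdorffMeasure_le_and_lintegral_le`,
   `euclideanHausdorffMeasure_eq_lintegral_sqrt_det`): with the continuity of the density this gives
   `μHE[dim] s ≤ C^{dim+1} ∫_{φ s} √det` and conversely for measurable `s` in a small open set
   around each point; a countable subcover of the chart domain (taken in the second countable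
   model space) and a disjointification give the same two inequalities for every measurable
   `S ⊆ φ.source` and every `C > 1`, whence equality.

No new definitions are introduced: the chart linearization `A` is a hypothesis
`∀ w, ‖A w‖ = ‖e.symmL ℝ p₀ w‖`, and the density is the explicit expression
`√(det (⟪e.symmL p eᵢ, e.symmL p eⱼ⟫)ᵢⱼ)` for an orthonormal basis `e` of the model space.

## References

* H. Federer, *Geometric Measure Theory*, Springer 1969, §2.10.11 (Lipschitz maps and `H^m`),
  §3.2.3 (area formula), §3.2.46 (Hausdorff measure of a Riemannian manifold = Riemannian volume).
* I. Chavel, *Riemannian Geometry: A Modern Introduction*, 2nd ed., CUP 2006, §III.3 (Riemannian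
  measure `√g dx`), §III.5, (III.5.1) (`dH^n = dV` on a Riemannian manifold).
* D. Burago, Yu. Burago, S. Ivanov, *A course in metric geometry*, AMS 2001, §5.1 (charts are
  locally bi-Lipschitz, with constants close to `1`, for the length metric).
* A. Burtscher, *Length structures on manifolds with continuous Riemannian metrics*, New York J.
  Math. 21 (2015) 273–296, §4 (the same for continuous metrics).
-/

open Manifold Bundle Set Filter Metric Module MeasureTheory Measure
open scoped ContDiff Topology ENNReal NNReal

noncomputable section

namespace Literature.Geometry.Lorentzian

/-! ### The metric in a chart is continuous -/

section ChartMetric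

variable {F : Type*} [NormedAddCommGroup F] [InnerProductSpace ℝ F]
  {H : Type*} [TopologicalSpace H] {I : ModelWithCorners ℝ F H}
  {M : Type*} [TopologicalSpace M] [ChartedSpace H M] [IsManifold I 1 M]

/-- **Constant coordinate vector fields are continuous.** For the trivialization `e` of the
tangent bundle at `x` and a fixed vector `v` of the model space, `p ↦ (p, e.symmL p v)` is
continuous on the chart domain as a map into the tangent bundle. [folklore] -/
theorem continuousOn_totalSpaceMk_symmL (x : M) (v : F) :
    ContinuousOn (fun p ↦ (⟨p, (trivializationAt F (TangentSpace I) x).symmL ℝ p v⟩ :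
      TotalSpace F (TangentSpace I : M → Type _))) (chartAt H x).source := by
  have hb : (trivializationAt F (TangentSpace I) x).baseSet = (chartAt H x).source := by simp
  have h1 : ContinuousOn (fun p : M ↦ TotalSpace.mk' F p
      ((trivializationAt F (TangentSpace I) x).symm p v))
      (trivializationAt F (TangentSpace I) x).baseSet :=
    (trivializationAt F (TangentSpace I) x).continuousOn_symm.comp
      (continuous_id.prodMk continuous_const).continuousOn
      (fun p (hp : p ∈ _) ↦ (mk_mem_prod hp (mem_univ v)))
  rw [← hb]
  refine h1.congr (fun p hp ↦ ?_)
  simp [Trivialization.symmL_apply _ hp]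

variable [RiemannianBundle (fun x : M ↦ TangentSpace I x)]
  [IsContinuousRiemannianBundle F (fun x : M ↦ TangentSpace I x)]

/-- **The coefficients of the metric in a chart are continuous**: for fixed vectors `v, w` of the
model space, `p ↦ ⟪e.symmL p v, e.symmL p w⟫_p = h_p(D(φ⁻¹) v, D(φ⁻¹) w)` is continuous on the
chart domain (`e` the trivialization of the tangent bundle at `x`, `φ = extChartAt I x`).
Lee, *Introduction to Riemannian Manifolds* (2018), Ch. 2 (smooth case). [folklore] -/
theorem continuousOn_inner_symmL_symmL (x : M) (v w : F) :
    ContinuousOn (fun p ↦ inner ℝ ((trivializationAt F (TangentSpace I) x).symmL ℝ p v)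
      ((trivializationAt F (TangentSpace I) x).symmL ℝ p w)) (chartAt H x).source :=
  ContinuousOn.inner_bundle (continuousOn_totalSpaceMk_symmL x v)
    (continuousOn_totalSpaceMk_symmL x w)

/-- **The metric in a chart is continuous in operator norm**: the bilinear form
`(v, w) ↦ ⟪e.symmL p v, e.symmL p w⟫_p` on the (finite-dimensional) model space depends
continuously on the point `p` of the chart domain. [folklore] -/
theorem continuousOn_bilinearComp_symmL [FiniteDimensional ℝ F] (x : M) :
    ContinuousOn (fun p ↦ (innerSL ℝ (E := TangentSpace I p)).bilinearComp
      ((trivializationAt F (TangentSpace I) x).symmL ℝ p)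
      ((trivializationAt F (TangentSpace I) x).symmL ℝ p)) (chartAt H x).source := by
  refine continuousOn_clm_apply.2 (fun v ↦ ?_)
  refine continuousOn_clm_apply.2 (fun w ↦ ?_)
  simp only [ContinuousLinearMap.bilinearComp_apply, innerSL_apply_apply]
  exact continuousOn_inner_symmL_symmL x v w

end ChartMetric

/-! ### Linearization of a chart at a point and the sharp norm comparison -/

section Linearization

variable {F : Type*} [NormedAddCommGroup F] [InnerProductSpace ℝ F] [FiniteDimensional ℝ F]
  {H : Type*} [TopologicalSpace H] {I : ModelWithCorners ℝ F H}
  {M : Type*} [TopologicalSpace M] [ChartedSpace H M]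
  [RiemannianBundle (fun x : M ↦ TangentSpace I x)] [IsManifold I 1 M]

/-- **Existence of a chart linearization.** For every point `p₀` there is a continuous linear
map `A` of the model space with `‖A w‖ = ‖e.symmL p₀ w‖_{p₀}` for all `w` (compose
`e.symmL p₀ : F → T_{p₀}M` with a linear isometry of the inner product space `T_{p₀}M` onto `F`,
which exists as both have dimension `dim F`). In coordinates, `AᵀA = (h_{ij}(φ p₀))`. [folklore] -/
theorem exists_norm_eq_norm_symmL (x p₀ : M) :
    ∃ A : F →L[ℝ] F, ∀ w : F,
      ‖A w‖ = ‖(trivializationAt F (TangentSpace I) x).symmL ℝ p₀ w‖ := by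
  haveI : FiniteDimensional ℝ (TangentSpace I p₀) := inferInstanceAs (FiniteDimensional ℝ F)
  let L : TangentSpace I p₀ ≃ₗᵢ[ℝ] F :=
    (stdOrthonormalBasis ℝ (TangentSpace I p₀)).equiv (stdOrthonormalBasis ℝ F)
      (finCongr (rfl : finrank ℝ (TangentSpace I p₀) = finrank ℝ F))
  exact ⟨(L : TangentSpace I p₀ →L[ℝ] F) ∘L (trivializationAt F (TangentSpace I) x).symmL ℝ p₀,
    fun w ↦ by simp⟩

omit [FiniteDimensional ℝ F] in
/-- A chart linearization at a point of the chart domain is injective. [folklore] -/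
theorem injective_of_norm_eq_norm_symmL (x p₀ : M) (hp₀ : p₀ ∈ (chartAt H x).source)
    {A : F →L[ℝ] F}
    (hA : ∀ w : F, ‖A w‖ = ‖(trivializationAt F (TangentSpace I) x).symmL ℝ p₀ w‖) :
    Function.Injective A := by
  intro v w hvw
  have h1 : ‖A (v - w)‖ = 0 := by rw [map_sub, hvw, sub_self, norm_zero]
  rw [hA, norm_eq_zero] at h1
  have h2 := congrArg ((trivializationAt F (TangentSpace I) x).continuousLinearMapAt ℝ p₀) h1
  rw [(trivializationAt F (TangentSpace I) x).continuousLinearMapAt_symmL (by simpa using hp₀),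
    map_zero] at h2
  exact sub_eq_zero.1 h2

/-- A chart linearization at a point of the chart domain is a continuous linear equivalence.
[folklore] -/
theorem exists_continuousLinearEquiv_of_norm_eq_norm_symmL (x p₀ : M)
    (hp₀ : p₀ ∈ (chartAt H x).source) {A : F →L[ℝ] F}
    (hA : ∀ w : F, ‖A w‖ = ‖(trivializationAt F (TangentSpace I) x).symmL ℝ p₀ w‖) :
    ∃ Ae : F ≃L[ℝ] F, ∀ w, Ae w = A w :=
  ⟨(LinearEquiv.ofInjectiveEndo (A : F →ₗ[ℝ] F)
    (injective_of_norm_eq_norm_symmL x p₀ hp₀ hA)).toContinuousLinearEquiv, fun _ ↦ rfl⟩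

omit [FiniteDimensional ℝ F] in
/-- The inner products `⟪A v, A w⟫` of a chart linearization are the coefficients of the metric
in the chart, `⟪e.symmL p₀ v, e.symmL p₀ w⟫_{p₀}` (polarization). [folklore] -/
theorem inner_eq_inner_symmL_of_norm_eq (x p₀ : M) {A : F →L[ℝ] F}
    (hA : ∀ w : F, ‖A w‖ = ‖(trivializationAt F (TangentSpace I) x).symmL ℝ p₀ w‖) (v w : F) :
    inner ℝ (A v) (A w) = inner ℝ ((trivializationAt F (TangentSpace I) x).symmL ℝ p₀ v)
      ((trivializationAt F (TangentSpace I) x).symmL ℝ p₀ w) := by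
  rw [real_inner_eq_norm_add_mul_self_sub_norm_mul_self_sub_norm_mul_self_div_two,
    real_inner_eq_norm_add_mul_self_sub_norm_mul_self_sub_norm_mul_self_div_two,
    ← map_add, ← map_add, hA, hA, hA]

variable [IsContinuousRiemannianBundle F (fun x : M ↦ TangentSpace I x)]

set_option backward.isDefEq.respectTransparency false in
/-- **Local norm comparison in a chart, with constants arbitrarily close to `1`.** Fix the chart
at `x`, a point `p₀` of its domain, a chart linearization `A` at `p₀` (`‖A w‖ = ‖e.symmL p₀ w‖`)
and `C > 1`. Then for all `p` close to `p₀`: `‖e.symmL p w‖_p ≤ C ‖A w‖` for every `w` in the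
model space (`e.symmL p = D(φ⁻¹)(φ p)`), and `‖A (e p v)‖ ≤ C ‖v‖_p` for every tangent vector `v`
at `p` (`e p = Dφ_p`). This is the continuity of the metric in coordinates,
`h_p = (1 + o(1)) h_{p₀}` as quadratic forms. Burago–Burago–Ivanov, *A course in metric geometry*
(2001), §5.1; Burtscher (2015), §4. [folklore] -/
theorem eventually_norm_symmL_le_and_norm_comp_le (x p₀ : M)
    (hp₀ : p₀ ∈ (chartAt H x).source) {A : F →L[ℝ] F}
    (hA : ∀ w : F, ‖A w‖ = ‖(trivializationAt F (TangentSpace I) x).symmL ℝ p₀ w‖)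
    {C : ℝ≥0} (hC : 1 < C) :
    ∀ᶠ p in 𝓝 p₀, p ∈ (chartAt H x).source ∧
      (∀ w : F, ‖(trivializationAt F (TangentSpace I) x).symmL ℝ p w‖ ≤ C * ‖A w‖) ∧
      (∀ v : TangentSpace I p,
        ‖A ((trivializationAt F (TangentSpace I) x).continuousLinearMapAt ℝ p v)‖ ≤ C * ‖v‖) := by
  letI _iN : NormedAddCommGroup (F →L[ℝ] F →L[ℝ] ℝ) := ContinuousLinearMap.toNormedAddCommGroup
  -- the metric in the chart, as a bilinear form on the model space
  set B : M → (F →L[ℝ] F →L[ℝ] ℝ) := fun p ↦ (innerSL ℝ (E := TangentSpace I p)).bilinearComp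
      ((trivializationAt F (TangentSpace I) x).symmL ℝ p)
      ((trivializationAt F (TangentSpace I) x).symmL ℝ p) with hB_def
  have hB : ∀ p (w : F), B p w w = ‖(trivializationAt F (TangentSpace I) x).symmL ℝ p w‖ ^ 2 := by
    intro p w
    simp only [hB_def, ContinuousLinearMap.bilinearComp_apply, innerSL_apply_apply,
      real_inner_self_eq_norm_sq]
  -- `‖w‖ ≤ K ‖A w‖`
  obtain ⟨Ae, hAe⟩ := exists_continuousLinearEquiv_of_norm_eq_norm_symmL x p₀ hp₀ hA
  set K := ‖(Ae.symm : F →L[ℝ] F)‖ with hK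
  have hKA : ∀ w : F, ‖w‖ ≤ K * ‖A w‖ := by
    intro w
    conv_lhs => rw [← Ae.symm_apply_apply w]
    rw [hAe]
    exact (Ae.symm : F →L[ℝ] F).le_opNorm _
  have hC1 : (1 : ℝ) < C := by exact_mod_cast hC
  have hC0 : (0 : ℝ) < C := zero_lt_one.trans hC1
  have hCinv : (C : ℝ)⁻¹ ^ 2 < 1 := by
    have h1 : (C : ℝ)⁻¹ < 1 := inv_lt_one_of_one_lt₀ hC1
    have h2 : (0 : ℝ) ≤ (C : ℝ)⁻¹ := by positivity
    nlinarith
  set δ : ℝ := (1 - (C : ℝ)⁻¹ ^ 2) / (K ^ 2 + 1) with hδ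
  have hδpos : 0 < δ := div_pos (by linarith) (by positivity)
  have hδK : δ * K ^ 2 ≤ 1 - (C : ℝ)⁻¹ ^ 2 := by
    rw [hδ, div_mul_eq_mul_div, div_le_iff₀ (by positivity)]
    nlinarith [sq_nonneg K]
  have hcont : ContinuousAt B p₀ :=
    (continuousOn_bilinearComp_symmL x).continuousAt ((chartAt H x).open_source.mem_nhds hp₀)
  have hev : ∀ᶠ p in 𝓝 p₀, dist (B p) (B p₀) < δ := Metric.tendsto_nhds.1 hcont δ hδpos
  filter_upwards [hev, (chartAt H x).open_source.mem_nhds hp₀] with p hp hps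
  rw [dist_eq_norm] at hp
  -- the key two-sided estimate
  have key : ∀ w : F,
      |‖(trivializationAt F (TangentSpace I) x).symmL ℝ p w‖ ^ 2 - ‖A w‖ ^ 2|
        ≤ (1 - (C : ℝ)⁻¹ ^ 2) * ‖A w‖ ^ 2 := by
    intro w
    have h1 : ‖(trivializationAt F (TangentSpace I) x).symmL ℝ p w‖ ^ 2 - ‖A w‖ ^ 2
        = (B p - B p₀) w w := by
      rw [_root_.sub_apply, _root_.sub_apply, hB, hB, hA]
    rw [h1]
    calc |(B p - B p₀) w w|
        ≤ ‖B p - B p₀‖ * ‖w‖ * ‖w‖ := by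
          rw [← Real.norm_eq_abs]
          exact ContinuousLinearMap.le_opNorm₂ _ _ _
      _ ≤ δ * ‖w‖ * ‖w‖ := by gcongr
      _ = δ * ‖w‖ ^ 2 := by ring
      _ ≤ δ * (K * ‖A w‖) ^ 2 := by gcongr; exact hKA w
      _ = (δ * K ^ 2) * ‖A w‖ ^ 2 := by ring
      _ ≤ (1 - (C : ℝ)⁻¹ ^ 2) * ‖A w‖ ^ 2 := by gcongr
  have hCC : 2 - (C : ℝ)⁻¹ ^ 2 ≤ (C : ℝ) ^ 2 := by
    have h1 : (C : ℝ) * (C : ℝ)⁻¹ = 1 := mul_inv_cancel₀ hC0.ne'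
    nlinarith [sq_nonneg ((C : ℝ) - (C : ℝ)⁻¹)]
  have hCC' : (C : ℝ) ^ 2 * (C : ℝ)⁻¹ ^ 2 = 1 := by
    rw [← mul_pow, mul_inv_cancel₀ hC0.ne', one_pow]
  refine ⟨hps, fun w ↦ ?_, fun v ↦ ?_⟩
  · have ha := (abs_le.1 (key w)).2
    have h2 : ‖(trivializationAt F (TangentSpace I) x).symmL ℝ p w‖ ^ 2 ≤ (C * ‖A w‖) ^ 2 := by
      rw [mul_pow]
      nlinarith [sq_nonneg ‖A w‖]
    exact (pow_le_pow_iff_left₀ (norm_nonneg _) (by positivity) two_ne_zero).1 h2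
  · set w := (trivializationAt F (TangentSpace I) x).continuousLinearMapAt ℝ p v with hw_def
    have hw : (trivializationAt F (TangentSpace I) x).symmL ℝ p w = v :=
      (trivializationAt F (TangentSpace I) x).symmL_continuousLinearMapAt (by simpa using hps) v
    have ha := (abs_le.1 (key w)).1
    rw [hw] at ha
    have h2 : ‖A w‖ ^ 2 ≤ (C * ‖v‖) ^ 2 := by
      have h3 : (C : ℝ)⁻¹ ^ 2 * ‖A w‖ ^ 2 ≤ ‖v‖ ^ 2 := by nlinarith
      have h4 := mul_le_mul_of_nonneg_left h3 (sq_nonneg (C : ℝ))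
      rw [← mul_assoc, hCC', one_mul] at h4
      rw [mul_pow]
      exact h4
    exact (pow_le_pow_iff_left₀ (norm_nonneg _) (by positivity) two_ne_zero).1 h2

end Linearization

/-! ### Sharp two-sided comparison of the length distance with the linearized chart -/

section MetricComparison

variable {F : Type*} [NormedAddCommGroup F] [NormedSpace ℝ F]
  {H : Type*} [TopologicalSpace H] {I : ModelWithCorners ℝ F H}
  {M : Type*} [TopologicalSpace M] [ChartedSpace H M]
  [RiemannianBundle (fun x : M ↦ TangentSpace I x)] [IsManifold I 1 M]

omit [TopologicalSpace H] [ChartedSpace H M] [RiemannianBundle fun x : M ↦ TangentSpace I x]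
  [IsManifold I 1 M] in
/-- From `‖a‖ ≤ C ‖b‖` to the same inequality between extended norms. [folklore] -/
theorem enorm_le_coe_mul_enorm_of_norm_le {X Y : Type*} [SeminormedAddCommGroup X]
    [SeminormedAddCommGroup Y] {a : X} {b : Y} {C : ℝ≥0} (h : ‖a‖ ≤ C * ‖b‖) :
    ‖a‖ₑ ≤ (C : ℝ≥0∞) * ‖b‖ₑ := by
  have h' : ‖a‖₊ ≤ C * ‖b‖₊ := by
    rw [← NNReal.coe_le_coe, NNReal.coe_mul, coe_nnnorm, coe_nnnorm]
    exact h
  calc ‖a‖ₑ = (‖a‖₊ : ℝ≥0∞) := rfl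
    _ ≤ ((C * ‖b‖₊ : ℝ≥0) : ℝ≥0∞) := ENNReal.coe_le_coe.2 h'
    _ = (C : ℝ≥0∞) * ‖b‖ₑ := by rw [ENNReal.coe_mul]; rfl

omit [TopologicalSpace H] [ChartedSpace H M] [RiemannianBundle fun x : M ↦ TangentSpace I x]
  [IsManifold I 1 M] in
/-- The derivative of the segment map `t ↦ a + t (b - a)` within `[0, 1]` is `b - a`. [folklore] -/
theorem fderivWithin_lineMap_Icc_apply_one (a b : F) {t : ℝ} (ht : t ∈ Icc (0 : ℝ) 1) :
    fderivWithin ℝ (ContinuousAffineMap.lineMap (R := ℝ) a b) (Icc 0 1) t 1 = b - a := by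
  have h : HasDerivWithinAt (ContinuousAffineMap.lineMap (R := ℝ) a b) (b - a) (Icc 0 1) t := by
    rw [ContinuousAffineMap.coe_lineMap_eq]
    exact AffineMap.hasDerivWithinAt_lineMap
  rw [fderivWithin_derivWithin, h.derivWithin (uniqueDiffOn_Icc zero_lt_one t ht)]

set_option backward.isDefEq.respectTransparency false in
/-- **Upper bound for the Riemannian distance in a chart.** Let `φ = extChartAt I x`, let
`A` be a continuous linear map of the model space and `S` a convex subset of `φ.target` on which
`‖D(φ⁻¹)_z w‖ ≤ C ‖A w‖` for all `w`. Then `d(φ⁻¹ y, φ⁻¹ z) ≤ C ‖A y - A z‖` for all `y, z ∈ S`,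
where `d = riemannianEDist` is the length distance: the segment `[y, z]` pulls back to a `C¹` path
of length `≤ C ‖A y - A z‖`. Sharp-constant form of Mathlib's
`eventually_riemannianEDist_le_edist_extChartAt`; Burago–Burago–Ivanov, *A course in metric
geometry* (2001), §5.1. [folklore] -/
theorem riemannianEDist_symm_le_of_forall_norm_mfderivWithin_le (x : M) {C : ℝ≥0}
    (A : F →L[ℝ] F) {S : Set F} (hS : Convex ℝ S) (hSt : S ⊆ (extChartAt I x).target)
    (hD : ∀ z ∈ S, ∀ w : F,
      ‖mfderivWithin 𝓘(ℝ, F) I (extChartAt I x).symm (range I) z w‖ ≤ C * ‖A w‖)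
    {y z : F} (hy : y ∈ S) (hz : z ∈ S) :
    riemannianEDist I ((extChartAt I x).symm y) ((extChartAt I x).symm z)
      ≤ C * edist (A y) (A z) := by
  letI _i₁ : (p : F) → NormedAddCommGroup (TangentSpace 𝓘(ℝ, F) p) := fun p ↦
    normedAddCommGroupTangentSpaceVectorSpace p
  letI _i₂ : (p : F) → NormedSpace ℝ (TangentSpace 𝓘(ℝ, F) p) := fun p ↦
    normedSpaceTangentSpaceVectorSpace p
  -- Let `η` be the segment in the extended chart, and `γ` its composition with `φ⁻¹`.
  let η := ContinuousAffineMap.lineMap (R := ℝ) y z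
  set γ := (extChartAt I x).symm ∘ η
  have hη : Icc (0 : ℝ) 1 ⊆ ⇑η ⁻¹' S := by
    simp only [← image_subset_iff, ContinuousAffineMap.coe_lineMap_eq,
     ← segment_eq_image_lineMap, η]
    exact hS.segment_subset hy hz
  have η_smooth : CMDiff[Icc 0 1] 1 η := by
    apply ContMDiff.contMDiffOn
    rw [contMDiff_iff_contDiff]
    exact ContinuousAffineMap.contDiff _
  -- the Riemannian distance is bounded by the length of the specific path `γ`
  have hγ : riemannianEDist I ((extChartAt I x).symm y) ((extChartAt I x).symm z)
      ≤ pathELength I γ 0 1 := by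
    apply riemannianEDist_le_pathELength _ _ _ zero_le_one
    · exact (contMDiffOn_extChartAt_symm x).comp η_smooth (fun t ht ↦ hSt (hη ht))
    · simp [γ, η, ContinuousAffineMap.coe_lineMap_eq]
    · simp [γ, η, ContinuousAffineMap.coe_lineMap_eq]
  apply hγ.trans
  -- and the length of `γ` is controlled by the derivative bound on the controlled set
  rw [← lintegral_fderiv_lineMap_eq_edist, pathELength_eq_lintegral_mfderivWithin_Icc,
    ← lintegral_const_mul' _ _ ENNReal.coe_ne_top]
  apply setLIntegral_mono' measurableSet_Icc (fun t ht ↦ ?_)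
  have h₁ : mfderiv[Icc 0 1] γ t =
      (mfderiv[range I] (extChartAt I x).symm (η t)) ∘L (mfderiv[Icc 0 1] η t) := by
    apply mfderivWithin_comp
    · exact mdifferentiableWithinAt_extChartAt_symm (hSt (hη ht))
    · exact η_smooth.mdifferentiableOn one_ne_zero t ht
    · exact fun t ht ↦ extChartAt_target_subset_range x (hSt (hη ht))
    · rw [uniqueMDiffWithinAt_iff_uniqueDiffWithinAt]
      exact uniqueDiffOn_Icc zero_lt_one t ht
  have h₂ : mfderiv[Icc 0 1] γ t 1 =
      (mfderiv[range I] (extChartAt I x).symm (η t)) (mfderiv[Icc 0 1] η t 1) := congr($h₁ 1)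
  have h₃ : mfderiv[Icc 0 1] η t 1 = z - y := by
    rw [mfderivWithin_eq_fderivWithin]
    exact fderivWithin_lineMap_Icc_apply_one y z ht
  rw [h₂, h₃, fderivWithin_lineMap_Icc_apply_one (A y) (A z) ht, ← map_sub]
  exact enorm_le_coe_mul_enorm_of_norm_le (hD (η t) (hη ht) (z - y))

/-- **Lower bound for the Riemannian distance in a chart (charts are locally Lipschitz, sharp
form).** Let `φ = extChartAt I x`, `A` a continuous linear map of the model space, and `u` a
neighbourhood of `p₀` inside the chart domain on which `‖A (Dφ_q v)‖ ≤ C ‖v‖_q` for all tangent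
vectors `v`. Then on a smaller neighbourhood `s` of `p₀`,
`‖A (φ q) - A (φ q')‖ ≤ C · d(q, q')` for all `q, q' ∈ s` (`d = riemannianEDist`): a path from
`q` to `q'` of length close to `d(q, q')` stays in `u`, and the fundamental theorem of calculus
along `A ∘ φ ∘ γ` bounds the chart distance by `C` times the length. Sharp-constant form of
Mathlib's `setOf_riemannianEDist_lt_subset_nhds`; Burago–Burago–Ivanov (2001), §5.1.
[folklore] -/
theorem exists_enorm_sub_le_mul_riemannianEDist_of_forall_norm_le [RegularSpace M]
    [IsContinuousRiemannianBundle F (fun x : M ↦ TangentSpace I x)] (x p₀ : M)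
    {C : ℝ≥0} (A : F →L[ℝ] F) {u : Set M} (hu : u ∈ 𝓝 p₀)
    (hus : u ⊆ (chartAt H x).source)
    (hD : ∀ q ∈ u, ∀ v : TangentSpace I q,
      ‖A (mfderiv I 𝓘(ℝ, F) (extChartAt I x) q v)‖ ≤ C * ‖v‖) :
    ∃ s ∈ 𝓝 p₀, ∀ q ∈ s, ∀ q' ∈ s,
      ‖A (extChartAt I x q) - A (extChartAt I x q')‖ₑ ≤ C * riemannianEDist I q q' := by
  letI _i₁ : (p : F) → NormedAddCommGroup (TangentSpace 𝓘(ℝ, F) p) := fun p ↦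
    normedAddCommGroupTangentSpaceVectorSpace p
  letI _i₂ : (p : F) → NormedSpace ℝ (TangentSpace 𝓘(ℝ, F) p) := fun p ↦
    normedSpaceTangentSpaceVectorSpace p
  -- `u` contains a Riemannian ball `{d(p₀, ·) < c}`
  obtain ⟨c, c_pos, hc⟩ := setOf_riemannianEDist_lt_subset_nhds' I hu
  have c2_pos : (0 : ℝ≥0∞) < c / 2 := ENNReal.div_pos c_pos.ne' ENNReal.ofNat_ne_top
  have c4_pos : (0 : ℝ≥0∞) < c / 2 / 2 := ENNReal.div_pos c2_pos.ne' ENNReal.ofNat_ne_top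
  refine ⟨{q | riemannianEDist I p₀ q < c / 2 / 2}, eventually_riemannianEDist_lt I p₀ c4_pos,
    ?_⟩
  intro q hq q' hq'
  -- main estimate: a path from `q` to `q'` of length `< r ≤ c / 2` stays inside `u`
  have key : ∀ r, riemannianEDist I q q' < r → r ≤ c / 2 →
      ‖A (extChartAt I x q) - A (extChartAt I x q')‖ₑ ≤ C * r := by
    intro r hr hrc
    rcases exists_lt_locally_constant_of_riemannianEDist_lt hr zero_lt_one with
      ⟨γ, hγq, hγq', γ_smooth, hγ, -⟩
    -- the path stays in `u`
    have hγu : ∀ t ∈ Icc (0 : ℝ) 1, γ t ∈ u := by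
      intro t ht
      apply hc
      simp only [mem_setOf_eq]
      have h1 : riemannianEDist I q (γ t) ≤ pathELength I γ 0 t :=
        riemannianEDist_le_pathELength (γ_smooth.contMDiffOn (s := Icc 0 t)) hγq rfl ht.1
      have h2 : pathELength I γ 0 t ≤ pathELength I γ 0 1 := pathELength_mono le_rfl ht.2
      calc riemannianEDist I p₀ (γ t)
          ≤ riemannianEDist I p₀ q + riemannianEDist I q (γ t) := riemannianEDist_triangle
        _ < c / 2 / 2 + c / 2 := by
            refine ENNReal.add_lt_add hq ?_
            exact (h1.trans h2).trans_lt (hγ.trans_le hrc)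
        _ ≤ c / 2 + c / 2 := by
            gcongr
            exact ENNReal.half_le_self
        _ = c := ENNReal.add_halves c
    -- the image path in the chart, and its image under `A`
    let γ' := extChartAt I x ∘ γ
    have hC' : CMDiff[Icc 0 1] 1 γ' :=
      contMDiffOn_extChartAt.comp (I' := I) (t := (chartAt H x).source)
        γ_smooth.contMDiffOn (fun t ht ↦ hus (hγu t ht))
    have hC'd : ContDiffOn ℝ 1 γ' (Icc 0 1) := by rwa [← contMDiffOn_iff_contDiffOn]
    have hC'' : ContDiffOn ℝ 1 (⇑A ∘ γ') (Icc 0 1) := A.contDiff.comp_contDiffOn hC'd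
    have hderiv : ∀ t ∈ Icc (0 : ℝ) 1,
        derivWithin (⇑A ∘ γ') (Icc 0 1) t = A (mfderiv[Icc 0 1] γ' t 1) := by
      intro t ht
      have hd : HasDerivWithinAt γ' (derivWithin γ' (Icc 0 1) t) (Icc 0 1) t :=
        ((hC'd t ht).differentiableWithinAt one_ne_zero).hasDerivWithinAt
      rw [(A.hasFDerivAt.comp_hasDerivWithinAt t hd).derivWithin
        (uniqueDiffOn_Icc zero_lt_one t ht)]
      simp only [← fderivWithin_derivWithin, mfderivWithin_eq_fderivWithin]
      rfl
    calc ‖A (extChartAt I x q) - A (extChartAt I x q')‖ₑ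
        = ‖(⇑A ∘ γ') 1 - (⇑A ∘ γ') 0‖ₑ := by
          rw [enorm_sub_rev]
          simp [γ', hγq, hγq']
      _ ≤ ∫⁻ t in Icc (0 : ℝ) 1, ‖derivWithin (⇑A ∘ γ') (Icc 0 1) t‖ₑ :=
          enorm_sub_le_lintegral_derivWithin_Icc_of_contDiffOn_Icc hC'' zero_le_one
      _ ≤ ∫⁻ t in Icc (0 : ℝ) 1, C * ‖mfderiv[Icc 0 1] γ t 1‖ₑ := by
          apply setLIntegral_mono' measurableSet_Icc (fun t ht ↦ ?_)
          rw [hderiv t ht]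
          have hcomp : mfderiv[Icc 0 1] γ' t =
              (mfderiv% (extChartAt I x) (γ t)) ∘L (mfderiv[Icc 0 1] γ t) := by
            apply mfderiv_comp_mfderivWithin
            · exact mdifferentiableAt_extChartAt (hus (hγu t ht))
            · exact (γ_smooth.mdifferentiable one_ne_zero).mdifferentiableOn _ ht
            · rw [uniqueMDiffWithinAt_iff_uniqueDiffWithinAt]
              exact uniqueDiffOn_Icc zero_lt_one _ ht
          have hcomp1 : mfderiv[Icc 0 1] γ' t 1 =
              (mfderiv% (extChartAt I x) (γ t)) (mfderiv[Icc 0 1] γ t 1) :=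
            congr($hcomp 1)
          rw [hcomp1]
          exact enorm_le_coe_mul_enorm_of_norm_le (hD (γ t) (hγu t ht) _)
      _ = C * pathELength I γ 0 1 := by
          rw [lintegral_const_mul' _ _ ENNReal.coe_ne_top,
            pathELength_eq_lintegral_mfderivWithin_Icc]
      _ ≤ C * r := by
          gcongr
  -- letting `r ↓ d(q, q')`
  have hd : riemannianEDist I q q' < c / 2 := by
    calc riemannianEDist I q q'
        ≤ riemannianEDist I q p₀ + riemannianEDist I p₀ q' := riemannianEDist_triangle
      _ < c / 2 / 2 + c / 2 / 2 := by
          refine ENNReal.add_lt_add ?_ hq'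
          rw [riemannianEDist_comm]
          exact hq
      _ = c / 2 := ENNReal.add_halves (c / 2)
  obtain ⟨r₀, hr₀, hr₀c⟩ := exists_between hd
  rcases eq_or_ne C 0 with rfl | hC0'
  · have h := key r₀ hr₀ hr₀c.le
    simp only [ENNReal.coe_zero, zero_mul, nonpos_iff_eq_zero] at h
    rw [h]
    exact bot_le
  have hC0 : (C : ℝ≥0∞) ≠ 0 := by exact_mod_cast hC0'
  have hdiv : ‖A (extChartAt I x q) - A (extChartAt I x q')‖ₑ / C ≤ riemannianEDist I q q' := by
    refine le_of_forall_gt_imp_ge_of_dense fun r hr ↦ ?_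
    have h := key (min r r₀) (lt_min hr hr₀) ((min_le_right _ _).trans hr₀c.le)
    calc ‖A (extChartAt I x q) - A (extChartAt I x q')‖ₑ / C ≤ min r r₀ :=
          ENNReal.div_le_of_le_mul' h
      _ ≤ r := min_le_left _ _
  calc ‖A (extChartAt I x q) - A (extChartAt I x q')‖ₑ
      = C * (‖A (extChartAt I x q) - A (extChartAt I x q')‖ₑ / C) := by
        rw [ENNReal.mul_div_cancel hC0 ENNReal.coe_ne_top]
    _ ≤ C * riemannianEDist I q q' := by gcongr

end MetricComparison

section BiLipschitz

variable {F : Type*} [NormedAddCommGroup F] [InnerProductSpace ℝ F] [FiniteDimensional ℝ F]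
  {H : Type*} [TopologicalSpace H] {I : ModelWithCorners ℝ F H}
  {M : Type*} [TopologicalSpace M] [ChartedSpace H M]
  [RiemannianBundle (fun x : M ↦ TangentSpace I x)] [IsManifold I 1 M] [RegularSpace M]
  [IsContinuousRiemannianBundle F (fun x : M ↦ TangentSpace I x)]

set_option backward.isDefEq.respectTransparency false in
/-- **Charts are locally almost isometric after linearization.** Fix the chart `φ` at `x`, a
point `p₀` of its domain, a chart linearization `A` at `p₀` (`‖A w‖ = ‖e.symmL p₀ w‖_{p₀}`, the
Riemannian length at `p₀` of the coordinate vector `w`) and `C > 1`. Then on a neighbourhood `U`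
of `p₀` the map `A ∘ φ` is `C`-bi-Lipschitz for the Riemannian length distance:
`C⁻¹ ‖A φ q - A φ q'‖ ≤ d(q, q') ≤ C ‖A φ q - A φ q'‖`. Burago–Burago–Ivanov, *A course in
metric geometry* (2001), §5.1 (for continuous Riemannian metrics: A. Burtscher, *Length
structures on manifolds with continuous Riemannian metrics*, New York J. Math. 21 (2015), §4).
[folklore] -/
theorem exists_nhds_riemannianEDist_le_and_edist_le (x p₀ : M)
    (hp₀ : p₀ ∈ (chartAt H x).source) {A : F →L[ℝ] F}
    (hA : ∀ w : F, ‖A w‖ = ‖(trivializationAt F (TangentSpace I) x).symmL ℝ p₀ w‖)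
    {C : ℝ≥0} (hC : 1 < C) :
    ∃ U ∈ 𝓝 p₀, U ⊆ (chartAt H x).source ∧
      (∀ q ∈ U, ∀ q' ∈ U, riemannianEDist I q q' ≤
        C * edist (A (extChartAt I x q)) (A (extChartAt I x q'))) ∧
      (∀ q ∈ U, ∀ q' ∈ U,
        edist (A (extChartAt I x q)) (A (extChartAt I x q')) ≤ C * riemannianEDist I q q') := by
  -- the set `W` where the norm comparisons hold
  have hW := eventually_norm_symmL_le_and_norm_comp_le (I := I) x p₀ hp₀ hA hC
  set W := {p : M | p ∈ (chartAt H x).source ∧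
      (∀ w : F, ‖(trivializationAt F (TangentSpace I) x).symmL ℝ p w‖ ≤ C * ‖A w‖) ∧
      (∀ v : TangentSpace I p,
        ‖A ((trivializationAt F (TangentSpace I) x).continuousLinearMapAt ℝ p v)‖ ≤ C * ‖v‖)}
    with hW_def
  have hWmem : W ∈ 𝓝 p₀ := hW
  have hWs : W ⊆ (chartAt H x).source := fun p hp ↦ hp.1
  -- lower bound: `A ∘ φ` is `C`-Lipschitz near `p₀`
  have hD₂ : ∀ q ∈ W, ∀ v : TangentSpace I q,
      ‖A (mfderiv I 𝓘(ℝ, F) (extChartAt I x) q v)‖ ≤ C * ‖v‖ := by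
    intro q hq v
    rw [← TangentBundle.continuousLinearMapAt_trivializationAt hq.1]
    exact hq.2.2 v
  obtain ⟨s₁, hs₁, h₁⟩ :=
    exists_enorm_sub_le_mul_riemannianEDist_of_forall_norm_le x p₀ A hWmem hWs hD₂
  -- upper bound: transport the first comparison to the chart
  have hp₀' : p₀ ∈ (extChartAt I x).source := by rwa [extChartAt_source]
  set V := {z : F | z ∈ (extChartAt I x).target ∧
      ∀ w : F, ‖mfderivWithin 𝓘(ℝ, F) I (extChartAt I x).symm (range I) z w‖ ≤ C * ‖A w‖}
    with hV_def
  have hV : V ∈ 𝓝[range I] (extChartAt I x p₀) := by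
    have h1 : (extChartAt I x).symm ⁻¹' W ∈ 𝓝 (extChartAt I x p₀) :=
      extChartAt_preimage_mem_nhds' hp₀' hWmem
    filter_upwards [nhdsWithin_le_nhds h1, extChartAt_target_mem_nhdsWithin' hp₀'] with z hz hzt
    refine ⟨hzt, fun w ↦ ?_⟩
    have hq : (extChartAt I x).symm z ∈ (chartAt H x).source := hz.1
    have hb := hz.2.1 w
    rw [TangentBundle.symmL_trivializationAt hq, (extChartAt I x).right_inv hzt] at hb
    exact hb
  obtain ⟨r, r_pos, hr⟩ : ∃ r > 0, ball (extChartAt I x p₀) r ∩ range I ⊆ V :=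
    mem_nhdsWithin_iff.1 hV
  have hSconv : Convex ℝ (ball (extChartAt I x p₀) r ∩ range I) :=
    (convex_ball _ _).inter I.convex_range
  have hSt : ball (extChartAt I x p₀) r ∩ range I ⊆ (extChartAt I x).target :=
    fun z hz ↦ (hr hz).1
  have hDS : ∀ z ∈ ball (extChartAt I x p₀) r ∩ range I, ∀ w : F,
      ‖mfderivWithin 𝓘(ℝ, F) I (extChartAt I x).symm (range I) z w‖ ≤ C * ‖A w‖ :=
    fun z hz ↦ (hr hz).2
  have hs₂ : (extChartAt I x) ⁻¹' ball (extChartAt I x p₀) r ∈ 𝓝 p₀ :=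
    (continuousAt_extChartAt' hp₀').preimage_mem_nhds (ball_mem_nhds _ r_pos)
  refine ⟨s₁ ∩ (extChartAt I x) ⁻¹' ball (extChartAt I x p₀) r ∩ (chartAt H x).source,
    inter_mem (inter_mem hs₁ hs₂) ((chartAt H x).open_source.mem_nhds hp₀),
    inter_subset_right, ?_, ?_⟩
  · rintro q ⟨⟨-, hq⟩, hqs⟩ q' ⟨⟨-, hq'⟩, hq's⟩
    have hqS : extChartAt I x q ∈ ball (extChartAt I x p₀) r ∩ range I :=
      ⟨hq, mem_range_self _⟩
    have hq'S : extChartAt I x q' ∈ ball (extChartAt I x p₀) r ∩ range I :=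
      ⟨hq', mem_range_self _⟩
    have := riemannianEDist_symm_le_of_forall_norm_mfderivWithin_le x A hSconv hSt hDS hqS hq'S
    rwa [(extChartAt I x).left_inv (by rwa [extChartAt_source]),
      (extChartAt I x).left_inv (by rwa [extChartAt_source])] at this
  · rintro q ⟨⟨hq, -⟩, -⟩ q' ⟨⟨hq', -⟩, -⟩
    rw [edist_eq_enorm_sub]
    exact h₁ q hq q' hq'

end BiLipschitz

/-! ### Hausdorff measures -/

section HausdorffComparison

variable {F : Type*} [NormedAddCommGroup F] [InnerProductSpace ℝ F] [FiniteDimensional ℝ F]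
  [MeasurableSpace F] [BorelSpace F]
  {H : Type*} [TopologicalSpace H] {I : ModelWithCorners ℝ F H}
  {M : Type*} [EMetricSpace M] [ChartedSpace H M]
  [RiemannianBundle (fun x : M ↦ TangentSpace I x)] [IsManifold I 1 M]
  [IsContinuousRiemannianBundle F (fun x : M ↦ TangentSpace I x)] [IsRiemannianManifold I M]
  [MeasurableSpace M] [BorelSpace M]

/-- **Hausdorff measure of the length metric vs. Hausdorff measure in the linearized chart.**
Around every point `p₀` of the domain of the chart `φ` at `x`, for every chart linearization `A`
at `p₀` and every `C > 1` there is a neighbourhood `U` of `p₀` such that for every `s ⊆ U`: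
`μH[d] s ≤ C^d · μH[d] (A (φ s))` and `μH[d] (A (φ s)) ≤ C^d · μH[d] s`, the Hausdorff measures
being taken for the Riemannian length distance on `M` and the Euclidean distance on the model
space (Lipschitz maps expand `μH[d]` by at most `Lip^d`: Federer, *Geometric Measure Theory*
(1969), §2.10.11). [cite: Federer1969, §2.10.11] -/
theorem exists_nhds_hausdorffMeasure_le_and_le (x p₀ : M) (hp₀ : p₀ ∈ (chartAt H x).source)
    {A : F →L[ℝ] F}
    (hA : ∀ w : F, ‖A w‖ = ‖(trivializationAt F (TangentSpace I) x).symmL ℝ p₀ w‖)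
    {C : ℝ≥0} (hC : 1 < C) {d : ℝ} (hd : 0 ≤ d) :
    ∃ U ∈ 𝓝 p₀, U ⊆ (chartAt H x).source ∧ ∀ s ⊆ U,
      μH[d] s ≤ (C : ℝ≥0∞) ^ d * μH[d] (A '' (extChartAt I x '' s)) ∧
      μH[d] (A '' (extChartAt I x '' s)) ≤ (C : ℝ≥0∞) ^ d * μH[d] s := by
  obtain ⟨U, hU, hUs, h₁, h₂⟩ :=
    exists_nhds_riemannianEDist_le_and_edist_le (I := I) x p₀ hp₀ hA hC
  obtain ⟨Ae, hAe⟩ := exists_continuousLinearEquiv_of_norm_eq_norm_symmL x p₀ hp₀ hA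
  refine ⟨U, hU, hUs, fun s hs ↦ ?_⟩
  set Ψ : M → F := fun q ↦ A (extChartAt I x q) with hΨ
  have hΨs : Ψ '' s = A '' (extChartAt I x '' s) := by
    rw [image_image]
  -- `Ψ` is `C`-Lipschitz on `U`
  have hL₁ : LipschitzOnWith C Ψ U := by
    intro q hq q' hq'
    rw [IsRiemannianManifold.out (I := I) q q']
    exact h₂ q hq q' hq'
  -- its inverse is `C`-Lipschitz on `Ψ '' U`
  have hinv : ∀ q ∈ U, ((extChartAt I x).symm ∘ Ae.symm) (Ψ q) = q := by
    intro q hq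
    simp only [Function.comp_apply, hΨ]
    rw [← hAe, Ae.symm_apply_apply,
      (extChartAt I x).left_inv (by rw [extChartAt_source]; exact hUs hq)]
  have hL₂ : LipschitzOnWith C ((extChartAt I x).symm ∘ Ae.symm) (Ψ '' U) := by
    rintro _ ⟨q, hq, rfl⟩ _ ⟨q', hq', rfl⟩
    rw [hinv q hq, hinv q' hq', IsRiemannianManifold.out (I := I) q q']
    exact h₁ q hq q' hq'
  have hs' : s ⊆ ((extChartAt I x).symm ∘ Ae.symm) '' (Ψ '' s) :=
    fun q hq ↦ ⟨Ψ q, mem_image_of_mem Ψ hq, hinv q (hs hq)⟩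
  constructor
  · calc μH[d] s ≤ μH[d] (((extChartAt I x).symm ∘ Ae.symm) '' (Ψ '' s)) := measure_mono hs'
      _ ≤ (C : ℝ≥0∞) ^ d * μH[d] (Ψ '' s) :=
          (hL₂.mono (image_mono hs)).hausdorffMeasure_image_le hd
      _ = (C : ℝ≥0∞) ^ d * μH[d] (A '' (extChartAt I x '' s)) := by rw [hΨs]
  · rw [← hΨs]
    exact (hL₁.mono hs).hausdorffMeasure_image_le hd

end HausdorffComparison

/-! ### The density `√(det h_{ij})` -/

section GramDet

variable {F : Type*} [NormedAddCommGroup F] [InnerProductSpace ℝ F]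
  {ι : Type*} [Fintype ι] [DecidableEq ι]

/-- **Gram determinant identity**: for a linear map `A` and an orthonormal basis `b` of a real
inner product space, `det (⟪A bᵢ, A bⱼ⟫)ᵢⱼ = (det A)²` (the Gram matrix is `Tᵀ T` for the matrix
`T` of `A` in the basis `b`). [folklore] -/
theorem det_gram_eq_sq_det (b : OrthonormalBasis ι ℝ F) (A : F →ₗ[ℝ] F) :
    (Matrix.of fun i j ↦ inner ℝ (A (b i)) (A (b j))).det = (LinearMap.det A) ^ 2 := by
  have h : (Matrix.of fun i j ↦ inner ℝ (A (b i)) (A (b j))) =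
      (LinearMap.toMatrix b.toBasis b.toBasis A).transpose *
        (LinearMap.toMatrix b.toBasis b.toBasis A) := by
    ext i j
    simp only [Matrix.of_apply, Matrix.mul_apply, Matrix.transpose_apply, LinearMap.toMatrix_apply,
      OrthonormalBasis.coe_toBasis_repr_apply, OrthonormalBasis.repr_apply_apply,
      OrthonormalBasis.coe_toBasis]
    rw [← b.sum_inner_mul_inner (A (b i)) (A (b j))]
    refine Finset.sum_congr rfl (fun k _ ↦ ?_)
    rw [real_inner_comm (b k)]
  rw [h, Matrix.det_mul, Matrix.det_transpose, LinearMap.det_toMatrix, sq]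

/-- `√(det Gram) = |det A|` for the Gram matrix of `A` in an orthonormal basis. [folklore] -/
theorem sqrt_det_gram_eq_abs_det (b : OrthonormalBasis ι ℝ F) (A : F →ₗ[ℝ] F) :
    Real.sqrt (Matrix.of fun i j ↦ inner ℝ (A (b i)) (A (b j))).det = |LinearMap.det A| := by
  rw [det_gram_eq_sq_det, Real.sqrt_sq_eq_abs]

end GramDet

section Density

variable {F : Type*} [NormedAddCommGroup F] [InnerProductSpace ℝ F] [FiniteDimensional ℝ F]
  {H : Type*} [TopologicalSpace H] {I : ModelWithCorners ℝ F H}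
  {M : Type*} [TopologicalSpace M] [ChartedSpace H M]
  [RiemannianBundle (fun x : M ↦ TangentSpace I x)] [IsManifold I 1 M]
  {ι : Type*} [Fintype ι] [DecidableEq ι]

omit [FiniteDimensional ℝ F] in
/-- **The Riemannian density in a chart is `|det A|`.** For a chart linearization `A` at `p`
(`‖A w‖ = ‖e.symmL p w‖_p`) and any orthonormal basis `b` of the model space,
`√(det (⟪e.symmL p bᵢ, e.symmL p bⱼ⟫_p)ᵢⱼ) = |det A|`; here `⟪e.symmL p bᵢ, e.symmL p bⱼ⟫_p =
h_{ij}(φ p)` are the coefficients of the metric in the chart. Chavel, *Riemannian Geometry*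
(2006), §III.3. [folklore] -/
theorem sqrt_det_gram_symmL_eq_abs_det (b : OrthonormalBasis ι ℝ F) (x p : M) {A : F →L[ℝ] F}
    (hA : ∀ w : F, ‖A w‖ = ‖(trivializationAt F (TangentSpace I) x).symmL ℝ p w‖) :
    Real.sqrt (Matrix.of fun i j ↦
        inner ℝ ((trivializationAt F (TangentSpace I) x).symmL ℝ p (b i))
          ((trivializationAt F (TangentSpace I) x).symmL ℝ p (b j))).det =
      |LinearMap.det (A : F →ₗ[ℝ] F)| := by
  rw [← sqrt_det_gram_eq_abs_det b]
  congr 3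
  ext i j
  simp only [ContinuousLinearMap.coe_coe, inner_eq_inner_symmL_of_norm_eq x p hA]

/-- The Riemannian density in a chart is positive on the chart domain. [folklore] -/
theorem sqrt_det_gram_symmL_pos (b : OrthonormalBasis ι ℝ F) (x p : M)
    (hp : p ∈ (chartAt H x).source) :
    0 < Real.sqrt (Matrix.of fun i j ↦
        inner ℝ ((trivializationAt F (TangentSpace I) x).symmL ℝ p (b i))
          ((trivializationAt F (TangentSpace I) x).symmL ℝ p (b j))).det := by
  obtain ⟨A, hA⟩ := exists_norm_eq_norm_symmL (I := I) x p
  obtain ⟨Ae, hAe⟩ := exists_continuousLinearEquiv_of_norm_eq_norm_symmL x p hp hA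
  rw [sqrt_det_gram_symmL_eq_abs_det b x p hA, abs_pos]
  have : (A : F →ₗ[ℝ] F) = (Ae.toLinearEquiv : F →ₗ[ℝ] F) := by
    ext w; exact (hAe w).symm
  rw [this]
  exact (LinearEquiv.isUnit_det' Ae.toLinearEquiv).ne_zero

variable [IsContinuousRiemannianBundle F (fun x : M ↦ TangentSpace I x)]

omit [FiniteDimensional ℝ F] in
/-- The Riemannian density in a chart is continuous on the chart domain. [folklore] -/
theorem continuousOn_sqrt_det_gram_symmL (b : OrthonormalBasis ι ℝ F) (x : M) :
    ContinuousOn (fun p ↦ Real.sqrt (Matrix.of fun i j ↦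
        inner ℝ ((trivializationAt F (TangentSpace I) x).symmL ℝ p (b i))
          ((trivializationAt F (TangentSpace I) x).symmL ℝ p (b j))).det)
      (chartAt H x).source := by
  let G : M → Matrix ι ι ℝ := fun p i j ↦
    inner ℝ ((trivializationAt F (TangentSpace I) x).symmL ℝ p (b i))
      ((trivializationAt F (TangentSpace I) x).symmL ℝ p (b j))
  have hG : ContinuousOn G (chartAt H x).source :=
    continuousOn_pi.2 fun i ↦ continuousOn_pi.2 fun j ↦ continuousOn_inner_symmL_symmL x (b i) (b j)
  have hdet : ContinuousOn (fun p ↦ (G p).det) (chartAt H x).source :=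
    (continuous_id.matrix_det).comp_continuousOn hG
  exact Real.continuous_sqrt.comp_continuousOn hdet

end Density

/-! ### Measurability of chart images -/

section ChartMeasurable

variable {E : Type*} [NormedAddCommGroup E] [NormedSpace ℝ E] [MeasurableSpace E] [BorelSpace E]
  {H : Type*} [TopologicalSpace H] {I : ModelWithCorners ℝ E H}
  {M : Type*} [TopologicalSpace M] [ChartedSpace H M] [MeasurableSpace M] [BorelSpace M]

omit [MeasurableSpace M] [BorelSpace M] in
/-- The target of an extended chart is measurable. [folklore] -/
theorem measurableSet_extChartAt_target (x : M) : MeasurableSet (extChartAt I x).target := by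
  rw [extChartAt_target]
  exact ((chartAt H x).open_target.preimage I.continuous_symm).measurableSet.inter
    I.isClosed_range.measurableSet

/-- **Chart images of measurable subsets of the chart domain are measurable** (the inverse chart
is continuous on the measurable target). [folklore] -/
theorem measurableSet_image_extChartAt (x : M) {s : Set M} (hs : MeasurableSet s)
    (hss : s ⊆ (extChartAt I x).source) : MeasurableSet (extChartAt I x '' s) := by
  classical
  rw [PartialEquiv.image_eq_target_inter_inv_preimage _ hss]
  have hc : ContinuousOn (extChartAt I x).symm (extChartAt I x).target :=
    continuousOn_extChartAt_symm x
  have ht : MeasurableSet (extChartAt I x).target := measurableSet_extChartAt_target x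
  have hm : Measurable ((extChartAt I x).target.piecewise (extChartAt I x).symm (fun _ ↦ x)) :=
    hc.measurable_piecewise continuousOn_const ht
  have : (extChartAt I x).target ∩ (extChartAt I x).symm ⁻¹' s =
      (extChartAt I x).target ∩
        ((extChartAt I x).target.piecewise (extChartAt I x).symm (fun _ ↦ x)) ⁻¹' s := by
    ext z
    simp only [mem_inter_iff, mem_preimage]
    constructor
    · rintro ⟨hz, hzs⟩; exact ⟨hz, by rwa [piecewise_eq_of_mem _ _ _ hz]⟩
    · rintro ⟨hz, hzs⟩; exact ⟨hz, by rwa [piecewise_eq_of_mem _ _ _ hz] at hzs⟩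
  rw [this]
  exact ht.inter (hm hs)

end ChartMeasurable

/-! ### Assembly: the Hausdorff measure of the length metric in a chart -/

section ChartFormula

variable {F : Type*} [NormedAddCommGroup F] [InnerProductSpace ℝ F] [FiniteDimensional ℝ F]
  [MeasurableSpace F] [BorelSpace F]
  {H : Type*} [TopologicalSpace H] {I : ModelWithCorners ℝ F H}
  {M : Type*} [EMetricSpace M] [ChartedSpace H M]
  [RiemannianBundle (fun x : M ↦ TangentSpace I x)] [IsManifold I 1 M]
  [IsContinuousRiemannianBundle F (fun x : M ↦ TangentSpace I x)] [IsRiemannianManifold I M]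
  [MeasurableSpace M] [BorelSpace M]
  {ι : Type*} [Fintype ι] [DecidableEq ι]

/-- **Local two-sided comparison of the Hausdorff measure of the length metric with
`∫ √(det h_{ij}) dy` in a chart.** Around every point `p₀` of the domain of the chart `φ` at `x`
and for every `C > 1` there is an open neighbourhood `U` such that for every measurable `s ⊆ U`,
`μHE[n] s ≤ C^(n+1) ∫_{φ s} ρ` and `∫_{φ s} ρ ≤ C^(n+1) μHE[n] s`, where `n = dim`, `μHE[n]` is the
Euclidean-normalised Hausdorff measure of the Riemannian length distance and
`ρ(z) = √(det h_{ij}(z))`, `h_{ij}(z) = ⟪e.symmL (φ⁻¹ z) bᵢ, e.symmL (φ⁻¹ z) bⱼ⟫` for an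
orthonormal basis `b` of the model space. Federer, *Geometric Measure Theory* (1969), §3.2.3
(area formula) and §3.2.46. [cite: Federer1969, §3.2.3 and §3.2.46] -/
theorem exists_isOpen_euclideanHausdorffMeasure_le_and_lintegral_le (b : OrthonormalBasis ι ℝ F)
    (x p₀ : M) (hp₀ : p₀ ∈ (chartAt H x).source) {C : ℝ≥0} (hC : 1 < C) :
    ∃ U : Set M, IsOpen U ∧ p₀ ∈ U ∧ U ⊆ (chartAt H x).source ∧ ∀ s ⊆ U, MeasurableSet s →
      μHE[finrank ℝ F] s ≤ (C : ℝ≥0∞) ^ (finrank ℝ F) * C *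
          ∫⁻ z in extChartAt I x '' s, ENNReal.ofReal (Real.sqrt (Matrix.of fun i j ↦
            inner ℝ ((trivializationAt F (TangentSpace I) x).symmL ℝ ((extChartAt I x).symm z) (b i))
              ((trivializationAt F (TangentSpace I) x).symmL ℝ ((extChartAt I x).symm z) (b j))).det) ∧
      ∫⁻ z in extChartAt I x '' s, ENNReal.ofReal (Real.sqrt (Matrix.of fun i j ↦
            inner ℝ ((trivializationAt F (TangentSpace I) x).symmL ℝ ((extChartAt I x).symm z) (b i))
              ((trivializationAt F (TangentSpace I) x).symmL ℝ ((extChartAt I x).symm z) (b j))).det) ≤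
          (C : ℝ≥0∞) ^ (finrank ℝ F) * C * μHE[finrank ℝ F] s := by
  set n := finrank ℝ F with hn
  -- the density, as a function on the manifold
  set ρ : M → ℝ := fun p ↦ Real.sqrt (Matrix.of fun i j ↦
      inner ℝ ((trivializationAt F (TangentSpace I) x).symmL ℝ p (b i))
        ((trivializationAt F (TangentSpace I) x).symmL ℝ p (b j))).det with hρ_def
  -- a chart linearization at `p₀` and the corresponding bi-Lipschitz neighbourhood
  obtain ⟨A, hA⟩ := exists_norm_eq_norm_symmL (I := I) x p₀
  obtain ⟨U₁, hU₁, hU₁s, hH⟩ := exists_nhds_hausdorffMeasure_le_and_le (I := I) x p₀ hp₀ hA hC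
    (d := (n : ℝ)) (Nat.cast_nonneg n)
  -- continuity and positivity of the density at `p₀`
  set ρ₀ := ρ p₀ with hρ₀_def
  have hρ₀A : ρ₀ = |LinearMap.det (A : F →ₗ[ℝ] F)| := sqrt_det_gram_symmL_eq_abs_det b x p₀ hA
  have hρ₀ : 0 < ρ₀ := sqrt_det_gram_symmL_pos b x p₀ hp₀
  have hC1 : (1 : ℝ) < C := by exact_mod_cast hC
  have hC0 : (0 : ℝ) < C := zero_lt_one.trans hC1
  have hcont : ContinuousAt ρ p₀ :=
    (continuousOn_sqrt_det_gram_symmL b x).continuousAt ((chartAt H x).open_source.mem_nhds hp₀)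
  have hU₂ : {p | ρ p < C * ρ₀ ∧ ρ₀ < C * ρ p} ∈ 𝓝 p₀ := by
    have h1 : ∀ᶠ p in 𝓝 p₀, ρ p < C * ρ₀ := hcont.eventually (gt_mem_nhds (by nlinarith))
    have h2 : ∀ᶠ p in 𝓝 p₀, ρ₀ / C < ρ p :=
      hcont.eventually (lt_mem_nhds (by rw [div_lt_iff₀ hC0]; nlinarith))
    filter_upwards [h1, h2] with p hp1 hp2
    refine ⟨hp1, ?_⟩
    rw [div_lt_iff₀ hC0] at hp2
    linarith [mul_comm (ρ p) (C : ℝ)]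
  set U := interior (U₁ ∩ {p | ρ p < C * ρ₀ ∧ ρ₀ < C * ρ p}) with hU_def
  refine ⟨U, isOpen_interior, mem_interior_iff_mem_nhds.2 (inter_mem hU₁ hU₂),
    interior_subset.trans (inter_subset_left.trans hU₁s), fun s hs hsm ↦ ?_⟩
  have hs₁ : s ⊆ U₁ := hs.trans (interior_subset.trans inter_subset_left)
  have hs₂ : ∀ q ∈ s, ρ q < C * ρ₀ ∧ ρ₀ < C * ρ q := fun q hq ↦ (interior_subset (hs hq)).2
  have hss : s ⊆ (extChartAt I x).source := by
    rw [extChartAt_source]; exact hs₁.trans hU₁s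
  obtain ⟨h1, h2⟩ := hH s hs₁
  rw [ENNReal.rpow_natCast] at h1 h2
  set B := extChartAt I x '' s with hB
  have hBm : MeasurableSet B := measurableSet_image_extChartAt x hsm hss
  -- volumes in the model space
  have hvol : (μHE[n] : Measure F) (A '' B) = ENNReal.ofReal ρ₀ * volume B := by
    rw [hn, InnerProductSpace.euclideanHausdorffMeasure_eq_volume, hρ₀A]
    exact addHaar_image_continuousLinearMap volume A B
  -- density bounds on `B`
  have hg_le : ∀ z ∈ B, ENNReal.ofReal (ρ ((extChartAt I x).symm z)) ≤ C * ENNReal.ofReal ρ₀ := by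
    rintro _ ⟨q, hq, rfl⟩
    rw [(extChartAt I x).left_inv (hss hq), ← ENNReal.ofReal_coe_nnreal,
      ← ENNReal.ofReal_mul hC0.le]
    exact ENNReal.ofReal_le_ofReal (hs₂ q hq).1.le
  have hg_ge : ∀ z ∈ B, ENNReal.ofReal ρ₀ ≤ C * ENNReal.ofReal (ρ ((extChartAt I x).symm z)) := by
    rintro _ ⟨q, hq, rfl⟩
    rw [(extChartAt I x).left_inv (hss hq), ← ENNReal.ofReal_coe_nnreal,
      ← ENNReal.ofReal_mul hC0.le]
    exact ENNReal.ofReal_le_ofReal (hs₂ q hq).2.le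
  have hI_le : ∫⁻ z in B, ENNReal.ofReal (ρ ((extChartAt I x).symm z))
      ≤ C * ENNReal.ofReal ρ₀ * volume B := by
    calc ∫⁻ z in B, ENNReal.ofReal (ρ ((extChartAt I x).symm z))
        ≤ ∫⁻ _ in B, C * ENNReal.ofReal ρ₀ := setLIntegral_mono' hBm hg_le
      _ = C * ENNReal.ofReal ρ₀ * volume B := setLIntegral_const _ _
  have hI_ge : ENNReal.ofReal ρ₀ * volume B
      ≤ C * ∫⁻ z in B, ENNReal.ofReal (ρ ((extChartAt I x).symm z)) := by
    calc ENNReal.ofReal ρ₀ * volume B = ∫⁻ _ in B, ENNReal.ofReal ρ₀ := (setLIntegral_const _ _).symm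
      _ ≤ ∫⁻ z in B, C * ENNReal.ofReal (ρ ((extChartAt I x).symm z)) :=
          setLIntegral_mono' hBm hg_ge
      _ = C * ∫⁻ z in B, ENNReal.ofReal (ρ ((extChartAt I x).symm z)) :=
          lintegral_const_mul' _ _ ENNReal.coe_ne_top
  -- `μHE = c • μH` on both sides
  set c : ℝ≥0∞ :=
    (addHaarScalarFactor (volume : Measure (EuclideanSpace ℝ (Fin n))) μH[n] : ℝ≥0∞) with hc
  have hM : (μHE[n] : Measure M) s = c * μH[n] s := by
    rw [euclideanHausdorffMeasure_def, Measure.smul_apply, ENNReal.smul_def, smul_eq_mul]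
  have hF : (μHE[n] : Measure F) (A '' B) = c * μH[n] (A '' B) := by
    rw [euclideanHausdorffMeasure_def, Measure.smul_apply, ENNReal.smul_def, smul_eq_mul]
  constructor
  · calc (μHE[n] : Measure M) s = c * μH[n] s := hM
      _ ≤ c * ((C : ℝ≥0∞) ^ n * μH[n] (A '' B)) := by gcongr
      _ = (C : ℝ≥0∞) ^ n * (μHE[n] : Measure F) (A '' B) := by rw [hF]; ring
      _ = (C : ℝ≥0∞) ^ n * (ENNReal.ofReal ρ₀ * volume B) := by rw [hvol]
      _ ≤ (C : ℝ≥0∞) ^ n * (C * ∫⁻ z in B, ENNReal.ofReal (ρ ((extChartAt I x).symm z))) := by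
          gcongr
      _ = (C : ℝ≥0∞) ^ n * C * ∫⁻ z in B, ENNReal.ofReal (ρ ((extChartAt I x).symm z)) := by
          rw [mul_assoc]
  · calc ∫⁻ z in B, ENNReal.ofReal (ρ ((extChartAt I x).symm z))
        ≤ C * ENNReal.ofReal ρ₀ * volume B := hI_le
      _ = C * (μHE[n] : Measure F) (A '' B) := by rw [hvol, mul_assoc]
      _ = C * (c * μH[n] (A '' B)) := by rw [hF]
      _ ≤ C * (c * ((C : ℝ≥0∞) ^ n * μH[n] s)) := by gcongr
      _ = (C : ℝ≥0∞) ^ n * C * (c * μH[n] s) := by ring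
      _ = (C : ℝ≥0∞) ^ n * C * (μHE[n] : Measure M) s := by rw [hM]

/-- **Global two-sided comparison, for every `C > 1`**: for every measurable subset `S` of the
domain of the chart `φ` at `x`, `μHE[n] S ≤ C^(n+1) ∫_{φ S} ρ` and `∫_{φ S} ρ ≤ C^(n+1) μHE[n] S`
(`ρ = √(det h_{ij})`), by a countable cover of the chart domain with the neighbourhoods of
`exists_isOpen_euclideanHausdorffMeasure_le_and_lintegral_le` (extracted in the second countable
model space) and a disjointification. Federer, *Geometric Measure Theory* (1969), §3.2.46.
[cite: Federer1969, §3.2.46] -/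
theorem euclideanHausdorffMeasure_le_and_lintegral_le (b : OrthonormalBasis ι ℝ F) (x : M)
    {C : ℝ≥0} (hC : 1 < C) {S : Set M} (hS : MeasurableSet S)
    (hSs : S ⊆ (extChartAt I x).source) :
    μHE[finrank ℝ F] S ≤ (C : ℝ≥0∞) ^ (finrank ℝ F) * C *
        ∫⁻ z in extChartAt I x '' S, ENNReal.ofReal (Real.sqrt (Matrix.of fun i j ↦
          inner ℝ ((trivializationAt F (TangentSpace I) x).symmL ℝ ((extChartAt I x).symm z) (b i))
            ((trivializationAt F (TangentSpace I) x).symmL ℝ ((extChartAt I x).symm z) (b j))).det) ∧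
      ∫⁻ z in extChartAt I x '' S, ENNReal.ofReal (Real.sqrt (Matrix.of fun i j ↦
          inner ℝ ((trivializationAt F (TangentSpace I) x).symmL ℝ ((extChartAt I x).symm z) (b i))
            ((trivializationAt F (TangentSpace I) x).symmL ℝ ((extChartAt I x).symm z) (b j))).det) ≤
        (C : ℝ≥0∞) ^ (finrank ℝ F) * C * μHE[finrank ℝ F] S := by
  classical
  set n := finrank ℝ F with hn
  set g : F → ℝ≥0∞ := fun z ↦ ENNReal.ofReal (Real.sqrt (Matrix.of fun i j ↦
      inner ℝ ((trivializationAt F (TangentSpace I) x).symmL ℝ ((extChartAt I x).symm z) (b i))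
        ((trivializationAt F (TangentSpace I) x).symmL ℝ ((extChartAt I x).symm z) (b j))).det)
    with hg
  rcases S.eq_empty_or_nonempty with rfl | hSne
  · simp
  -- the good neighbourhoods
  choose! U hUo hpU hUs hU using
    fun p (hp : p ∈ (chartAt H x).source) ↦
      exists_isOpen_euclideanHausdorffMeasure_le_and_lintegral_le (I := I) b x p hp hC
  -- a countable subcover, obtained in the (second countable) model space
  have hsrc : (extChartAt I x).source = (chartAt H x).source := extChartAt_source I x
  have hcov : ∀ z ∈ (extChartAt I x).target,
      (extChartAt I x).symm ⁻¹' U ((extChartAt I x).symm z) ∈ 𝓝[(extChartAt I x).target] z := by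
    intro z hz
    apply mem_nhdsWithin_of_mem_nhds
    apply (continuousAt_extChartAt_symm'' hz).preimage_mem_nhds
    have hz' : (extChartAt I x).symm z ∈ (chartAt H x).source := by
      rw [← hsrc]; exact (extChartAt I x).map_target hz
    exact (hUo _ hz').mem_nhds (hpU _ hz')
  obtain ⟨t, ht_sub, ht_count, ht_cover⟩ := TopologicalSpace.countable_cover_nhdsWithin hcov
  obtain ⟨q₀, hq₀⟩ := hSne
  have htne : t.Nonempty := by
    have : extChartAt I x q₀ ∈ ⋃ z ∈ t, (extChartAt I x).symm ⁻¹' U ((extChartAt I x).symm z) :=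
      ht_cover ((extChartAt I x).map_source (hSs hq₀))
    simp only [mem_iUnion] at this
    obtain ⟨z, hz, -⟩ := this
    exact ⟨z, hz⟩
  obtain ⟨e, he⟩ := ht_count.exists_eq_range htne
  -- the open cover `V k` of the chart domain and its disjointification
  set pt : ℕ → M := fun k ↦ (extChartAt I x).symm (e k) with hpt
  have hpt_mem : ∀ k, pt k ∈ (chartAt H x).source := by
    intro k
    rw [← hsrc]
    exact (extChartAt I x).map_target (ht_sub (he ▸ mem_range_self k))
  set V : ℕ → Set M := fun k ↦ U (pt k) with hV
  have hSV : S ⊆ ⋃ k, V k := by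
    intro q hq
    have : extChartAt I x q ∈ ⋃ z ∈ t, (extChartAt I x).symm ⁻¹' U ((extChartAt I x).symm z) :=
      ht_cover ((extChartAt I x).map_source (hSs hq))
    simp only [mem_iUnion, mem_preimage] at this
    obtain ⟨z, hz, hqz⟩ := this
    rw [(extChartAt I x).left_inv (hSs hq)] at hqz
    rw [he] at hz
    obtain ⟨k, rfl⟩ := hz
    exact mem_iUnion.2 ⟨k, hqz⟩
  set D : ℕ → Set M := disjointed V with hD
  set T : ℕ → Set M := fun k ↦ S ∩ D k with hT
  have hTm : ∀ k, MeasurableSet (T k) := fun k ↦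
    hS.inter (MeasurableSet.disjointed (fun j ↦ (hUo _ (hpt_mem j)).measurableSet) k)
  have hTd : Pairwise (Function.onFun Disjoint T) := fun i j hij ↦
    (disjoint_disjointed V hij).mono inter_subset_right inter_subset_right
  have hTS : ∀ k, T k ⊆ S := fun k ↦ inter_subset_left
  have hTV : ∀ k, T k ⊆ V k := fun k ↦ inter_subset_right.trans (disjointed_subset V k)
  have hST : S = ⋃ k, T k := by
    rw [hT]
    simp only [← inter_iUnion]
    rw [hD, iUnion_disjointed]
    exact (inter_eq_left.2 hSV).symm
  -- decompose both sides along the pieces `T k`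
  have hμ : (μHE[n] : Measure M) S = ∑' k, (μHE[n] : Measure M) (T k) := by
    conv_lhs => rw [hST]
    exact measure_iUnion hTd hTm
  have himm : ∀ k, MeasurableSet (extChartAt I x '' T k) := fun k ↦
    measurableSet_image_extChartAt x (hTm k) ((hTS k).trans hSs)
  have himd : Pairwise (Function.onFun Disjoint fun k ↦ extChartAt I x '' T k) := fun i j hij ↦
    (hTd hij).image (extChartAt I x).injOn ((hTS i).trans hSs) ((hTS j).trans hSs)
  have hI : ∫⁻ z in extChartAt I x '' S, g z = ∑' k, ∫⁻ z in extChartAt I x '' T k, g z := by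
    conv_lhs => rw [hST, image_iUnion]
    exact lintegral_iUnion himm himd g
  have hk : ∀ k, (μHE[n] : Measure M) (T k) ≤ (C : ℝ≥0∞) ^ n * C * ∫⁻ z in extChartAt I x '' T k, g z
      ∧ ∫⁻ z in extChartAt I x '' T k, g z ≤ (C : ℝ≥0∞) ^ n * C * (μHE[n] : Measure M) (T k) :=
    fun k ↦ hU (pt k) (hpt_mem k) (T k) (hTV k) (hTm k)
  constructor
  · rw [hμ, hI, ← ENNReal.tsum_mul_left]
    exact ENNReal.tsum_le_tsum (fun k ↦ (hk k).1)
  · rw [hμ, hI, ← ENNReal.tsum_mul_left]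
    exact ENNReal.tsum_le_tsum (fun k ↦ (hk k).2)

omit [FiniteDimensional ℝ F] [MeasurableSpace F] [BorelSpace F] [TopologicalSpace H]
  [ChartedSpace H M] [RiemannianBundle fun x : M ↦ TangentSpace I x] [IsManifold I 1 M]
  [IsContinuousRiemannianBundle F fun x : M ↦ TangentSpace I x] [IsRiemannianManifold I M]
  [MeasurableSpace M] [BorelSpace M] [Fintype ι] [DecidableEq ι] in
/-- `a ≤ C^(n+1) b` for all `C > 1` implies `a ≤ b` (in `ℝ≥0∞`; let `C ↓ 1`). [folklore] -/
theorem le_of_forall_one_lt_le_pow_mul {a b : ℝ≥0∞} (n : ℕ)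
    (h : ∀ C : ℝ≥0, 1 < C → a ≤ (C : ℝ≥0∞) ^ n * C * b) : a ≤ b := by
  have hcont : Continuous (fun C : ℝ≥0 ↦ ((C ^ n * C : ℝ≥0) : ℝ≥0∞)) :=
    ENNReal.continuous_coe.comp ((continuous_pow n).mul continuous_id)
  have ht : Tendsto (fun C : ℝ≥0 ↦ ((C ^ n * C : ℝ≥0) : ℝ≥0∞) * b) (𝓝[>] 1)
      (𝓝 (((1 ^ n * 1 : ℝ≥0) : ℝ≥0∞) * b)) :=
    ENNReal.Tendsto.mul_const ((hcont.tendsto 1).mono_left nhdsWithin_le_nhds) (Or.inl (by simp))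
  have hev : ∀ᶠ C in 𝓝[>] (1 : ℝ≥0), a ≤ ((C ^ n * C : ℝ≥0) : ℝ≥0∞) * b := by
    refine eventually_nhdsWithin_of_forall (fun C hC ↦ ?_)
    have := h C hC
    push_cast
    exact this
  simpa using ge_of_tendsto ht hev

/-- **The Hausdorff measure of the Riemannian length metric has density `√(det h_{ij})` in
charts** (Mathlib-style form of Federer's theorem). Let `M` be a `C¹` manifold modelled on the
finite-dimensional real inner product space `F`, whose tangent spaces carry a continuously
varying inner product, and whose extended distance is the length distance
(`IsRiemannianManifold`). For a measurable subset `S` of the domain of the chart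
`φ = extChartAt I x` and any orthonormal basis `b` of `F`:
`μHE[dim F] S = ∫_{φ S} √(det (⟪e.symmL (φ⁻¹ z) bᵢ, e.symmL (φ⁻¹ z) bⱼ⟫)ᵢⱼ) dz`, where `μHE` is
the Euclidean-normalised Hausdorff measure and `e.symmL (φ⁻¹ z) = D(φ⁻¹)(z)`
(`e = trivializationAt F (TangentSpace I) x`), so that the integrand is `√(det h_{ij}(z))`.
Federer, *Geometric Measure Theory* (1969), §3.2.46; Chavel, *Riemannian Geometry* (2006),
§III.3 and (III.5.1). [cite: Federer1969, §3.2.46] -/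
theorem euclideanHausdorffMeasure_eq_lintegral_sqrt_det (b : OrthonormalBasis ι ℝ F) (x : M)
    {S : Set M} (hS : MeasurableSet S) (hSs : S ⊆ (extChartAt I x).source) :
    μHE[finrank ℝ F] S =
      ∫⁻ z in extChartAt I x '' S, ENNReal.ofReal (Real.sqrt (Matrix.of fun i j ↦
        inner ℝ ((trivializationAt F (TangentSpace I) x).symmL ℝ ((extChartAt I x).symm z) (b i))
          ((trivializationAt F (TangentSpace I) x).symmL ℝ ((extChartAt I x).symm z) (b j))).det) := by
  apply le_antisymm
  · exact le_of_forall_one_lt_le_pow_mul (finrank ℝ F)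
      (fun C hC ↦ (euclideanHausdorffMeasure_le_and_lintegral_le b x hC hS hSs).1)
  · exact le_of_forall_one_lt_le_pow_mul (finrank ℝ F)
      (fun C hC ↦ (euclideanHausdorffMeasure_le_and_lintegral_le b x hC hS hSs).2)

end ChartFormula

/-! ### The named fact of `Volume.lean` -/

section Fact

variable {H : Type*} [TopologicalSpace H] {n : ℕ∞ω} {m : ℕ}
  {I : ModelWithCorners ℝ (EuclideanSpace ℝ (Fin m)) H}
  {N : Type*} [TopologicalSpace N] [ChartedSpace H N] [IsManifold I 1 N]

set_option backward.isDefEq.respectTransparency false in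
/-- The Gram matrix `chartGramMatrix h x z` of `Volume.lean` (built with
`mfderivWithin (extChartAt I x).symm (range I) z` and `h.inner`) is the Gram matrix, in the
standard basis `eᵢ = EuclideanSpace.single i 1`, of the inner products
`⟪e.symmL (φ⁻¹ z) eᵢ, e.symmL (φ⁻¹ z) eⱼ⟫` for the inner product space structure on the tangent
spaces registered by `h` (Mathlib's `TangentBundle.symmL_trivializationAt`), for `z` in the chart
target. [folklore] -/
theorem chartGramMatrix_eq_inner_symmL
    (h : ContMDiffRiemannianMetric I n (EuclideanSpace ℝ (Fin m)) (TangentSpace I : N → Type _))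
    (x : N) {z : EuclideanSpace ℝ (Fin m)} (hz : z ∈ (extChartAt I x).target) (i j : Fin m) :
    letI : RiemannianBundle (fun x : N ↦ TangentSpace I x) :=
      ⟨h.toContinuousRiemannianMetric.toRiemannianMetric⟩
    chartGramMatrix h x z i j =
      inner ℝ ((trivializationAt (EuclideanSpace ℝ (Fin m)) (TangentSpace I) x).symmL ℝ
          ((extChartAt I x).symm z) (EuclideanSpace.single i 1))
        ((trivializationAt (EuclideanSpace ℝ (Fin m)) (TangentSpace I) x).symmL ℝ
          ((extChartAt I x).symm z) (EuclideanSpace.single j 1)) := by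
  letI : RiemannianBundle (fun x : N ↦ TangentSpace I x) :=
    ⟨h.toContinuousRiemannianMetric.toRiemannianMetric⟩
  have hq : (extChartAt I x).symm z ∈ (chartAt H x).source := by
    rw [← extChartAt_source I]; exact (extChartAt I x).map_target hz
  rw [TangentBundle.symmL_trivializationAt hq, (extChartAt I x).right_inv hz]
  rfl

variable [T3Space N] [MeasurableSpace N] [BorelSpace N]

set_option backward.isDefEq.respectTransparency false in
/-- **Chart formula for the Riemannian measure** (discharge of the named fact
`riemannianMeasure_eq_integral_sqrt_det` of `Volume.lean`): for a `C^n` Riemannian metric `h` on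
a manifold `N` modelled on `ℝ^m` (any model with corners, `C¹` structure) and a measurable subset
`S` of the domain of the extended chart `φ` at `x`,
`riemannianMeasure h S = ∫_{φ S} √(det h_{ij}(y)) dy`, where `riemannianMeasure h` is the
Euclidean-normalised `m`-dimensional Hausdorff measure of the length metric of `h` and
`h_{ij} = chartGramMatrix h x` is the Gram matrix of the coordinate vector fields
(`euclideanHausdorffMeasure_eq_lintegral_sqrt_det` for the emetric structure
`EMetricSpace.ofRiemannianMetric` and the standard basis). Federer, *Geometric Measure Theory*
(1969), §3.2.3 and §3.2.46; Chavel, *Riemannian Geometry* (2006), §III.3, (III.5.1).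
[cite: Federer1969, §3.2.3 and §3.2.46] -/
theorem riemannianMeasure_eq_integral_sqrt_det_holds :
    riemannianMeasure_eq_integral_sqrt_det (I := I) (n := n) (N := N) := by
  intro h x S hS hSx
  letI : RiemannianBundle (fun x : N ↦ TangentSpace I x) :=
    ⟨h.toContinuousRiemannianMetric.toRiemannianMetric⟩
  letI : EMetricSpace N := EMetricSpace.ofRiemannianMetric I N
  haveI : IsRiemannianManifold I N := ⟨fun _ _ ↦ rfl⟩
  show (μHE[finrank ℝ (EuclideanSpace ℝ (Fin m))] : Measure N) S =
    ∫⁻ y in extChartAt I x '' S, ENNReal.ofReal (Real.sqrt (chartGramMatrix h x y).det)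
  rw [euclideanHausdorffMeasure_eq_lintegral_sqrt_det (EuclideanSpace.basisFun (Fin m) ℝ) x hS hSx]
  refine setLIntegral_congr_fun (measurableSet_image_extChartAt x hS hSx) ?_
  intro z hz
  have hzt : z ∈ (extChartAt I x).target := by
    obtain ⟨q, hq, rfl⟩ := hz
    exact (extChartAt I x).map_source (hSx hq)
  simp only
  congr 3
  ext i j
  rw [Matrix.of_apply, chartGramMatrix_eq_inner_symmL h x hzt, EuclideanSpace.basisFun_apply,
    EuclideanSpace.basisFun_apply]

end Fact

end Literature.Geometry.Lorentzian

end
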